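import Mathlib.Data.Nat.Choose.Basic
import Mathlib.Algebra.BigOperators.Intervals
import Mathlib.Algebra.Order.BigOperators.Group.Finset
import Mathlib.Tactic
import Summits.CriticalPhenomena.PercolationContinuityZ3.Theorems.PercNearOneGluingNoHeavyLowerTailShells
import HarnessLib

/-!
# Shell single-crossing and LEMMA S: adding a symmetric unimodal tilt to one block (CONJECTURE U)

Support file for the Sahi / Conjecture-P programme of route `PercNearOneGluingNoHeavy`
(`--supports stmt-CriticalPhenomena-4575`, prover prim-l12-p5 gen 28; proof note
`prim-l12-p5/U-STRUCTURE-g28.md` §1–3).  No definitions, no named facts, no sorries.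
Sequel of `…LowerTailShells` (windows `W(i)`, shells, `abel_window`); notation as there:
block 1 ∪ buffer is `(F₁, Mo₁)` on levels `0..n₁` with `F₁ > 0` exactly on `k ≤ n₁`, `F₁` symmetric and
`Mo₁` odd under `k ↦ n₁-k`; block 2 has `M₂` fair coins; `2K + j = n₁ + M₂`; `κ ≥ 0`;
`Φ(x) = κF₁(K-x) + (2x-M₂)Mo₁(K-x)`.  With `E(b) = F₁(b)+F₁(b+j)`, `D(b) = Mo₁(b)+Mo₁(b+j)` and
`V(b) = 2b+j-n₁`, the shell at depth `i` has value `C(M₂,i)[κE(b) − V(b)D(b)]`, `b = K-i`.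

* `sinv_step`, `sinv_propagate`, `val_nonpos_after` : SINGLE CROSSING — under the two-level
  monotonicity `D(b)E(b+1) ≤ D(b+1)E(b)` (tree: `TwoLevel.tlm_of_lc2`), a strictly negative shell value
  `κE(b₀) < V(b₀)D(b₀)` forces `κE(b) ≤ V(b)D(b)` at every level `b ≥ b₀` (every shell further out);
* `exists_neg_shell` : a negative window contains a strictly negative off-centre shell;
* `window_nonneg` : hence `W(0) ≥ 0 ⟹ W(i) ≥ 0` for all `i` (flat tilts of every depth);
* `lemma_S` : and `∑_x C(M₂,x) v(x) Φ(x) ≥ 0` for every symmetric unimodal `v ≥ 0` (LEMMA S, note §3).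
-/

namespace Summit.CriticalPhenomena.PercolationContinuityZ3.Theorems

namespace LemmaS

open Finset

variable (M₂ K : ℕ) (κ : ℝ) (F₁ Mo₁ : ℕ → ℝ)

/-- **Single-crossing step (strict, level form).**  Write `E(b) = F₁(b)+F₁(b+j)`,
`D(b) = Mo₁(b)+Mo₁(b+j)`, `V(b) = 2b+j-n₁`.  Under two-level monotonicity, `κ ≥ 0`, `F₁ ≥ 0` and
`Mo₁ = 0` where `F₁ = 0`: if `κE(b) < V(b)D(b)` with `V(b) ≥ 0` and `E(b+1) > 0`, then
`κE(b+1) < V(b+1)D(b+1)`. -/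
theorem sinv_step (n₁ j : ℕ) (hκ : 0 ≤ κ) (hF0 : ∀ k, 0 ≤ F₁ k) (hMoF : ∀ k, F₁ k = 0 → Mo₁ k = 0)
    (hTLM : ∀ b, (Mo₁ b + Mo₁ (b + j)) * (F₁ (b + 1) + F₁ (b + 1 + j)) ≤
      (Mo₁ (b + 1) + Mo₁ (b + 1 + j)) * (F₁ b + F₁ (b + j)))
    (b : ℕ) (hV : (n₁ : ℝ) ≤ 2 * (b : ℝ) + j)
    (hneg : κ * (F₁ b + F₁ (b + j)) < (2 * (b : ℝ) + j - n₁) * (Mo₁ b + Mo₁ (b + j)))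
    (hE1 : 0 < F₁ (b + 1) + F₁ (b + 1 + j)) :
    κ * (F₁ (b + 1) + F₁ (b + 1 + j)) <
      (2 * ((b + 1 : ℕ) : ℝ) + j - n₁) * (Mo₁ (b + 1) + Mo₁ (b + 1 + j)) := by
  set E0 := F₁ b + F₁ (b + j) with hE0
  set D0 := Mo₁ b + Mo₁ (b + j) with hD0
  set E1 := F₁ (b + 1) + F₁ (b + 1 + j) with hE1def
  set D1 := Mo₁ (b + 1) + Mo₁ (b + 1 + j) with hD1
  set V : ℝ := 2 * (b : ℝ) + j - n₁ with hVdef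
  have hV' : (2 * ((b + 1 : ℕ) : ℝ) + j - n₁) = V + 2 := by
    simp only [hVdef]
    push_cast
    ring
  rw [hV']
  have hVnn : 0 ≤ V := by
    simp only [hVdef]
    linarith
  have hE0pos : 0 ≤ E0 := add_nonneg (hF0 _) (hF0 _)
  have htlm : D0 * E1 ≤ D1 * E0 := hTLM b
  have hκE0 : 0 ≤ κ * E0 := mul_nonneg hκ hE0pos
  have hVD0pos : 0 < V * D0 := lt_of_le_of_lt hκE0 hneg
  have hD0pos : 0 < D0 := by
    rcases le_or_gt D0 0 with h | h
    · have : V * D0 ≤ 0 := mul_nonpos_of_nonneg_of_nonpos hVnn h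
      linarith
    · exact h
  have hVpos : 0 < V := by
    rcases le_or_gt V 0 with h | h
    · have hV0 : V = 0 := le_antisymm h hVnn
      rw [hV0] at hVD0pos
      simp at hVD0pos
    · exact h
  have hE0ne : E0 ≠ 0 := by
    intro hz
    have hFb : F₁ b = 0 := by
      have := hF0 b
      have := hF0 (b + j)
      linarith [hz]
    have hFbj : F₁ (b + j) = 0 := by
      have := hF0 b
      have := hF0 (b + j)
      linarith [hz]
    have hD : D0 = 0 := by
      simp only [hD0, hMoF b hFb, hMoF (b + j) hFbj, add_zero]
    rw [hD] at hD0pos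
    exact lt_irrefl _ hD0pos
  have hE0gt : 0 < E0 := lt_of_le_of_ne hE0pos (Ne.symm hE0ne)
  -- (V+2) D1 E0 ≥ V D1 E0 ≥ V D0 E1 > κ E0 E1
  have hD1E0 : 0 ≤ D1 * E0 := le_trans (mul_nonneg hD0pos.le hE1.le) htlm
  have hD1 : 0 ≤ D1 := nonneg_of_mul_nonneg_left hD1E0 hE0gt
  have key : κ * E1 * E0 < (V + 2) * D1 * E0 := by
    have h1 : κ * E0 * E1 < V * D0 * E1 := mul_lt_mul_of_pos_right hneg hE1
    have h2 : V * (D0 * E1) ≤ V * (D1 * E0) := mul_le_mul_of_nonneg_left htlm hVpos.le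
    have h3 : V * D1 * E0 ≤ (V + 2) * D1 * E0 := by nlinarith
    nlinarith
  exact lt_of_mul_lt_mul_right key hE0gt.le

/-- Propagation of the strict invariant along levels with `E > 0`. -/
theorem sinv_propagate (n₁ j : ℕ) (hκ : 0 ≤ κ) (hFz : ∀ k, n₁ < k → F₁ k = 0)
    (hFpos : ∀ k, k ≤ n₁ → 0 < F₁ k) (hMoz : ∀ k, n₁ < k → Mo₁ k = 0)
    (hTLM : ∀ b, (Mo₁ b + Mo₁ (b + j)) * (F₁ (b + 1) + F₁ (b + 1 + j)) ≤
      (Mo₁ (b + 1) + Mo₁ (b + 1 + j)) * (F₁ b + F₁ (b + j)))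
    (b₀ : ℕ) (hV : (n₁ : ℝ) ≤ 2 * (b₀ : ℝ) + j)
    (hneg : κ * (F₁ b₀ + F₁ (b₀ + j)) < (2 * (b₀ : ℝ) + j - n₁) * (Mo₁ b₀ + Mo₁ (b₀ + j))) :
    ∀ d, b₀ + d ≤ n₁ →
      κ * (F₁ (b₀ + d) + F₁ (b₀ + d + j)) <
        (2 * ((b₀ + d : ℕ) : ℝ) + j - n₁) * (Mo₁ (b₀ + d) + Mo₁ (b₀ + d + j)) := by
  have hF0 : ∀ k, 0 ≤ F₁ k := by
    intro k
    rcases le_or_gt k n₁ with hk | hk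
    · exact (hFpos k hk).le
    · rw [hFz k hk]
  have hMoF : ∀ k, F₁ k = 0 → Mo₁ k = 0 := by
    intro k hk
    rcases le_or_gt k n₁ with hk' | hk'
    · exact absurd hk (ne_of_gt (hFpos k hk'))
    · exact hMoz k hk'
  intro d
  induction d with
  | zero =>
    intro _
    simpa using hneg
  | succ d ih =>
    intro hd
    have hprev := ih (by omega)
    have hE1 : 0 < F₁ (b₀ + d + 1) + F₁ (b₀ + d + 1 + j) := by
      have := hFpos (b₀ + d + 1) (by omega)
      have := hF0 (b₀ + d + 1 + j)
      linarith
    have hVd : (n₁ : ℝ) ≤ 2 * ((b₀ + d : ℕ) : ℝ) + j := by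
      push_cast
      linarith
    have h := sinv_step κ F₁ Mo₁ n₁ j hκ hF0 hMoF hTLM (b₀ + d) hVd hprev hE1
    have e : b₀ + (d + 1) = b₀ + d + 1 := by ring
    rw [e]
    exact h

/-- After a strictly negative shell value at level `b₀`, every shell value at a level `b ≥ b₀` is
nonpositive. -/
theorem val_nonpos_after (n₁ j : ℕ) (hκ : 0 ≤ κ) (hFz : ∀ k, n₁ < k → F₁ k = 0)
    (hFpos : ∀ k, k ≤ n₁ → 0 < F₁ k) (hMoz : ∀ k, n₁ < k → Mo₁ k = 0)
    (hTLM : ∀ b, (Mo₁ b + Mo₁ (b + j)) * (F₁ (b + 1) + F₁ (b + 1 + j)) ≤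
      (Mo₁ (b + 1) + Mo₁ (b + 1 + j)) * (F₁ b + F₁ (b + j)))
    (b₀ : ℕ) (hV : (n₁ : ℝ) ≤ 2 * (b₀ : ℝ) + j)
    (hneg : κ * (F₁ b₀ + F₁ (b₀ + j)) < (2 * (b₀ : ℝ) + j - n₁) * (Mo₁ b₀ + Mo₁ (b₀ + j)))
    (b : ℕ) (hb : b₀ ≤ b) :
    κ * (F₁ b + F₁ (b + j)) - (2 * (b : ℝ) + j - n₁) * (Mo₁ b + Mo₁ (b + j)) ≤ 0 := by
  rcases le_or_gt b n₁ with hbn | hbn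
  · obtain ⟨d, rfl⟩ : ∃ d, b = b₀ + d := ⟨b - b₀, by omega⟩
    have h := sinv_propagate κ F₁ Mo₁ n₁ j hκ hFz hFpos hMoz hTLM b₀ hV hneg d hbn
    linarith
  · -- beyond the support everything vanishes
    rw [hFz b hbn, hFz (b + j) (by omega), hMoz b hbn, hMoz (b + j) (by omega)]
    simp

/-- A negative window contains a strictly negative (off-centre) shell. -/
theorem exists_neg_shell (n₁ j : ℕ) (hN : 2 * K + j = n₁ + M₂) (hκ : 0 ≤ κ)
    (hFz : ∀ k, n₁ < k → F₁ k = 0) (hFpos : ∀ k, k ≤ n₁ → 0 < F₁ k)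
    (hMoz : ∀ k, n₁ < k → Mo₁ k = 0)
    (hFsym : ∀ k, k ≤ n₁ → F₁ (n₁ - k) = F₁ k) (hMoodd : ∀ k, k ≤ n₁ → Mo₁ (n₁ - k) = -Mo₁ k) :
    ∀ m i, M₂ + 1 - i ≤ m →
      ∑ x ∈ range (M₂ + 1), (if i ≤ x ∧ x ≤ M₂ - i then (M₂.choose x : ℝ) *
        (if x ≤ K then κ * F₁ (K - x) + (2 * (x : ℝ) - M₂) * Mo₁ (K - x) else 0) else 0) < 0 →
      ∃ i', i ≤ i' ∧ 2 * i' < M₂ ∧ i' ≤ K ∧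
        κ * (F₁ (K - i') + F₁ (K - i' + j)) -
          ((M₂ : ℝ) - 2 * i') * (Mo₁ (K - i') + Mo₁ (K - i' + j)) < 0 := by
  have hF0 : ∀ k, 0 ≤ F₁ k := by
    intro k
    rcases le_or_gt k n₁ with hk | hk
    · exact (hFpos k hk).le
    · rw [hFz k hk]
  intro m
  induction m with
  | zero =>
    intro i hi hW
    rw [Shells.window_eq_zero M₂ _ i (by omega)] at hW
    exact absurd hW (lt_irrefl 0)
  | succ m ih =>
    intro i hi hW
    rcases Nat.lt_or_ge M₂ (2 * i) with hgt | hle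
    · rw [Shells.window_eq_zero M₂ _ i hgt] at hW
      exact absurd hW (lt_irrefl 0)
    · rw [Shells.window_succ M₂ _ i] at hW
      rcases Nat.lt_or_ge (2 * i) M₂ with hlt | hge
      · -- off-centre shell
        rcases Nat.lt_or_ge K i with hKi | hiK
        · -- i > K: shell vanishes, recurse
          rw [Shells.shell_eq_zero_of_lt M₂ K κ F₁ Mo₁ i hKi, zero_add] at hW
          obtain ⟨i', h1, h2, h3, h4⟩ := ih (i + 1) (by omega) hW
          exact ⟨i', by omega, h2, h3, h4⟩
        · rw [Shells.shell_eq M₂ K κ F₁ Mo₁ n₁ j hN hFz hMoz hFsym hMoodd i hlt hiK] at hW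
          by_cases hval : κ * (F₁ (K - i) + F₁ (K - i + j)) -
              ((M₂ : ℝ) - 2 * i) * (Mo₁ (K - i) + Mo₁ (K - i + j)) < 0
          · exact ⟨i, le_rfl, hlt, hiK, hval⟩
          · -- the shell is nonnegative, so the inner window is negative
            have hc : 0 ≤ (M₂.choose i : ℝ) := by positivity
            have hs : 0 ≤ (M₂.choose i : ℝ) * (κ * (F₁ (K - i) + F₁ (K - i + j)) -
                ((M₂ : ℝ) - 2 * i) * (Mo₁ (K - i) + Mo₁ (K - i + j))) :=
              mul_nonneg hc (not_lt.mp hval)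
            have hW' : ∑ x ∈ range (M₂ + 1), (if i + 1 ≤ x ∧ x ≤ M₂ - (i + 1) then (M₂.choose x : ℝ) *
                (if x ≤ K then κ * F₁ (K - x) + (2 * (x : ℝ) - M₂) * Mo₁ (K - x) else 0) else 0) < 0 := by
              linarith
            obtain ⟨i', h1, h2, h3, h4⟩ := ih (i + 1) (by omega) hW'
            exact ⟨i', by omega, h2, h3, h4⟩
      · -- centre shell: nonnegative, inner window empty
        have heq : 2 * i = M₂ := le_antisymm hle hge
        have hcen := Shells.shell_centre_nonneg M₂ K κ F₁ Mo₁ hκ hF0 i heq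
        rw [Shells.window_eq_zero M₂ _ (i + 1) (by omega), add_zero] at hW
        exact absurd hW (not_lt.mpr hcen)

/-- **Window nonnegativity (note §3, Lemma S for flat tilts).**  If the full (untilted) sum `W(0)` is
nonnegative then every centred-window sum `W(i)` is nonnegative. -/
theorem window_nonneg (n₁ j : ℕ) (hN : 2 * K + j = n₁ + M₂) (hκ : 0 ≤ κ)
    (hFz : ∀ k, n₁ < k → F₁ k = 0) (hFpos : ∀ k, k ≤ n₁ → 0 < F₁ k)
    (hMoz : ∀ k, n₁ < k → Mo₁ k = 0)
    (hFsym : ∀ k, k ≤ n₁ → F₁ (n₁ - k) = F₁ k) (hMoodd : ∀ k, k ≤ n₁ → Mo₁ (n₁ - k) = -Mo₁ k)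
    (hTLM : ∀ b, (Mo₁ b + Mo₁ (b + j)) * (F₁ (b + 1) + F₁ (b + 1 + j)) ≤
      (Mo₁ (b + 1) + Mo₁ (b + 1 + j)) * (F₁ b + F₁ (b + j)))
    (htot : 0 ≤ ∑ x ∈ range (M₂ + 1), (if 0 ≤ x ∧ x ≤ M₂ - 0 then (M₂.choose x : ℝ) *
        (if x ≤ K then κ * F₁ (K - x) + (2 * (x : ℝ) - M₂) * Mo₁ (K - x) else 0) else 0))
    (i : ℕ) :
    0 ≤ ∑ x ∈ range (M₂ + 1), (if i ≤ x ∧ x ≤ M₂ - i then (M₂.choose x : ℝ) *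
        (if x ≤ K then κ * F₁ (K - x) + (2 * (x : ℝ) - M₂) * Mo₁ (K - x) else 0) else 0) := by
  rcases le_or_gt 0 (∑ x ∈ range (M₂ + 1), (if i ≤ x ∧ x ≤ M₂ - i then (M₂.choose x : ℝ) *
        (if x ≤ K then κ * F₁ (K - x) + (2 * (x : ℝ) - M₂) * Mo₁ (K - x) else 0) else 0)) with h | h
  · exact h
  · exfalso
    -- a strictly negative shell i* ≥ i
    obtain ⟨i', hii', hlt, hiK, hval⟩ :=
      exists_neg_shell M₂ K κ F₁ Mo₁ n₁ j hN hκ hFz hFpos hMoz hFsym hMoodd (M₂ + 1 - i) i le_rfl h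
    -- in level form: b₀ = K - i', V = M₂ - 2 i' = 2 b₀ + j - n₁
    have hVeq : ((M₂ : ℝ) - 2 * i') = 2 * ((K - i' : ℕ) : ℝ) + j - n₁ := by
      have e : ((2 * K + j : ℕ) : ℝ) = ((n₁ + M₂ : ℕ) : ℝ) := by rw [hN]
      push_cast [Nat.cast_sub hiK] at e ⊢
      linarith
    have hV : (n₁ : ℝ) ≤ 2 * ((K - i' : ℕ) : ℝ) + j := by
      have : (0 : ℝ) ≤ (M₂ : ℝ) - 2 * i' := by
        have : ((2 * i' : ℕ) : ℝ) ≤ (M₂ : ℝ) := by exact_mod_cast hlt.le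
        push_cast at this
        linarith
      linarith
    rw [hVeq] at hval
    have hneg : κ * (F₁ (K - i') + F₁ (K - i' + j)) <
        (2 * ((K - i' : ℕ) : ℝ) + j - n₁) * (Mo₁ (K - i') + Mo₁ (K - i' + j)) := by linarith
    -- all shells i'' ≤ i' (levels b ≥ K - i') are nonpositive, so W(0) = W(i) + Σ_{i''<i} shell ≤ W(i) < 0
    have hshells : ∀ i'' ∈ range i, ∑ x ∈ range (M₂ + 1),
        (if (x = i'' ∨ x = M₂ - i'') ∧ 2 * i'' ≤ M₂ then (M₂.choose x : ℝ) *
          (if x ≤ K then κ * F₁ (K - x) + (2 * (x : ℝ) - M₂) * Mo₁ (K - x) else 0) else 0) ≤ 0 := by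
      intro i'' hi''
      have hi''i : i'' < i := mem_range.mp hi''
      have hlt'' : 2 * i'' < M₂ := by omega
      have hiK'' : i'' ≤ K := by omega
      rw [Shells.shell_eq M₂ K κ F₁ Mo₁ n₁ j hN hFz hMoz hFsym hMoodd i'' hlt'' hiK'']
      have hVeq'' : ((M₂ : ℝ) - 2 * i'') = 2 * ((K - i'' : ℕ) : ℝ) + j - n₁ := by
        have e : ((2 * K + j : ℕ) : ℝ) = ((n₁ + M₂ : ℕ) : ℝ) := by rw [hN]
        push_cast [Nat.cast_sub hiK''] at e ⊢
        linarith
      rw [hVeq'']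
      have hv := val_nonpos_after κ F₁ Mo₁ n₁ j hκ hFz hFpos hMoz hTLM (K - i') hV hneg
        (K - i'') (by omega)
      have e2 : K - i'' + j = K - i'' + j := rfl
      exact mul_nonpos_of_nonneg_of_nonpos (by positivity) hv
    have htel := Shells.window_telescope M₂
      (fun x => if x ≤ K then κ * F₁ (K - x) + (2 * (x : ℝ) - M₂) * Mo₁ (K - x) else 0) i
    have hsum : ∑ i'' ∈ range i, ∑ x ∈ range (M₂ + 1),
        (if (x = i'' ∨ x = M₂ - i'') ∧ 2 * i'' ≤ M₂ then (M₂.choose x : ℝ) *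
          (if x ≤ K then κ * F₁ (K - x) + (2 * (x : ℝ) - M₂) * Mo₁ (K - x) else 0) else 0) ≤ 0 :=
      sum_nonpos hshells
    rw [htel] at htot
    linarith

/-- **LEMMA S (note §3).**  Under the hypotheses of `window_nonneg`, the two-block sum with any
symmetric unimodal weight `v ≥ 0` on block 2 is nonnegative:
`0 ≤ ∑_x C(M₂,x) v(x) Φ(x)`. -/
theorem lemma_S (n₁ j : ℕ) (hN : 2 * K + j = n₁ + M₂) (hκ : 0 ≤ κ)
    (hFz : ∀ k, n₁ < k → F₁ k = 0) (hFpos : ∀ k, k ≤ n₁ → 0 < F₁ k)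
    (hMoz : ∀ k, n₁ < k → Mo₁ k = 0)
    (hFsym : ∀ k, k ≤ n₁ → F₁ (n₁ - k) = F₁ k) (hMoodd : ∀ k, k ≤ n₁ → Mo₁ (n₁ - k) = -Mo₁ k)
    (hTLM : ∀ b, (Mo₁ b + Mo₁ (b + j)) * (F₁ (b + 1) + F₁ (b + 1 + j)) ≤
      (Mo₁ (b + 1) + Mo₁ (b + 1 + j)) * (F₁ b + F₁ (b + j)))
    (htot : 0 ≤ ∑ x ∈ range (M₂ + 1), (M₂.choose x : ℝ) *
        (if x ≤ K then κ * F₁ (K - x) + (2 * (x : ℝ) - M₂) * Mo₁ (K - x) else 0))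
    (v : ℕ → ℝ) (hvpos : ∀ x, 0 ≤ v x) (hvsym : ∀ x, x ≤ M₂ → v x = v (M₂ - x))
    (hvuni : ∀ x, 2 * x + 2 ≤ M₂ → v x ≤ v (x + 1)) :
    0 ≤ ∑ x ∈ range (M₂ + 1), (M₂.choose x : ℝ) * v x *
        (if x ≤ K then κ * F₁ (K - x) + (2 * (x : ℝ) - M₂) * Mo₁ (K - x) else 0) := by
  set Φ : ℕ → ℝ := fun x => if x ≤ K then κ * F₁ (K - x) + (2 * (x : ℝ) - M₂) * Mo₁ (K - x) else 0
    with hΦ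
  -- window sums of a(x) = C(M₂,x) Φ(x) are nonnegative
  have htot' : 0 ≤ ∑ x ∈ range (M₂ + 1),
      (if 0 ≤ x ∧ x ≤ M₂ - 0 then (M₂.choose x : ℝ) * Φ x else 0) := by
    have e : ∑ x ∈ range (M₂ + 1), (if 0 ≤ x ∧ x ≤ M₂ - 0 then (M₂.choose x : ℝ) * Φ x else 0) =
        ∑ x ∈ range (M₂ + 1), (M₂.choose x : ℝ) * Φ x := by
      refine sum_congr rfl fun x hx => ?_
      have : x ≤ M₂ := by
        have := mem_range.mp hx
        omega
      rw [if_pos ⟨Nat.zero_le x, by omega⟩]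
    rw [e]
    exact htot
  have hW : ∀ i, 0 ≤ ∑ x ∈ range (M₂ + 1),
      (if i ≤ x ∧ x ≤ M₂ - i then (M₂.choose x : ℝ) * Φ x else 0) :=
    fun i => window_nonneg M₂ K κ F₁ Mo₁ n₁ j hN hκ hFz hFpos hMoz hFsym hMoodd hTLM htot' i
  have h := Shells.abel_window M₂ (fun x => (M₂.choose x : ℝ) * Φ x) hW (M₂ + 1) 0 (by omega) v
    (fun x _ _ => hvpos x) hvsym hvuni
  have e : ∑ x ∈ range (M₂ + 1), (if 0 ≤ x ∧ x ≤ M₂ - 0 then (M₂.choose x : ℝ) * Φ x * v x else 0) =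
      ∑ x ∈ range (M₂ + 1), (M₂.choose x : ℝ) * v x * Φ x := by
    refine sum_congr rfl fun x hx => ?_
    have : x ≤ M₂ := by
      have := mem_range.mp hx
      omega
    rw [if_pos ⟨Nat.zero_le x, by omega⟩]
    ring
  rw [e] at h
  exact h

end LemmaS

end Summit.CriticalPhenomena.PercolationContinuityZ3.Theorems
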